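import Summits.AtomisticToContinuum.FouriersLaw.Theses.VanishingNoiseTransfer
import Summits.AtomisticToContinuum.FouriersLaw.Theses.OddSectorIrreversibility
import Summits.AtomisticToContinuum.FouriersLaw.Theorems.OddSectorIrreversibilityResponseDensityLeOne
import Literature.MathematicalPhysics.KineticTheory.LangevinChainGibbs

/-!
# Response density of the deterministic steady family: the cases `N ≤ 1` and the bridge from
difference quotients (helpers for stub `stub_responseDensityDet`)

Helper file `--supports stmt-AtomisticToContinuum-11975` (crux `NoiseLocality`, route
`VanishingNoiseTransfer`, line `relative-flip-energy-transfer`, stub 1a `stub_responseDensityDet`).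

The stub asks, for the unique deterministic weak steady family `μ T_L T_R` of the `N`-chain and
`T > 0`, for an `L²(μ_T)` RESPONSE DENSITY `U` (`μ_T = gibbsMeasure N T`):
`d/dδ ∫ g dμ_{T+δ/2,T-δ/2} |₀ = ∫ g U dμ_T` for every `g ∈ C_c^∞` (as a `HasDerivAt` at `0`) and the
same for the total current `∑_i ∫ j_i`. This file proves, sorry-free:

* `of_le_one` — the stub's conclusion for EVERY oscillator chain with at most one site (`N ≤ 1`),
  with `U = 0`: for `N = 1` both baths act on the single momentum at temperature `(T_L + T_R)/2`,
  so by uniqueness `μ_{T+δ/2,T-δ/2} = μ_{T,T}` for `|δ| < 2T` (`isSteadyState_iff_of_le_one`), and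
  all the functions to be differentiated are constant near `δ = 0`;
* `of_tendsto_slope` — the BRIDGE from the difference-quotient form of sibling item
  stmt-AtomisticToContinuum-9144 (`OddSectorIrreversibility.ResponseDensity`: limits along `𝓝[≠] 0`
  of `δ⁻¹(∫F dμ_δ - ∫F dμ_{T,T})` for `F ∈ C_c^∞` and for each bond current) to the stub's
  `HasDerivAt` form (`hasDerivAt_iff_tendsto_slope`, `HasDerivAt.fun_sum`), given
  `μ T T = gibbsMeasure N T`;
* `steadyFamily_eq_gibbsMeasure` — under the stub's uniqueness hypothesis `μ T T` IS the Gibbs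
  measure (`pinnedChain_isSteadyState_gibbsMeasure`);
* `of_nessUnique_of_responseDensity` — the stub statement VERBATIM from the two existing open items
  `VanishingNoiseTransfer.NessUnique` (stmt-0741) and `OddSectorIrreversibility.ResponseDensity`
  (stmt-9144), taken BY NAME as hypotheses: choose a global reference steady family
  (`pinnedChain_exists_isSteadyState`), apply 9144 to it, and identify the given per-`N` family
  with it near `δ = 0` by uniqueness.

So after this file the stub is exactly the dependency edge `0741 ∧ 9144` (fixed-`N` Hairer–Majda
linear response of the hypoelliptic Langevin chain), and closed outright for `N ≤ 1`.
No definitions.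
-/

noncomputable section

open MeasureTheory Filter Topology
open scoped ContDiff

namespace Summit.AtomisticToContinuum.FouriersLaw.Theorems.NoiseLocality.StubResponseDensityDet

open Literature.MathematicalPhysics.KineticTheory.HeatConduction

/-! ### `N ≤ 1`: the family is constant along the anti-diagonal near `δ = 0` -/

/-- For a chain with at most one site, `T > 0`, and a family `μ` of weak steady states that is
unique at `(T, T)`: `μ (T + δ/2) (T - δ/2) = μ T T` for all `|δ| < 2T`, hence eventually along
`𝓝 0` (both baths act on the same momentum, so being steady only depends on `T_L + T_R`). -/
theorem steadyFamily_eventuallyEq_nhds_of_le_one (P : OscillatorChain) {N : ℕ} (hN : N ≤ 1)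
    {T : ℝ} (hT : 0 < T) (μ : ℝ → ℝ → Measure (PhaseSpace N))
    (hμ : ∀ T_L T_R : ℝ, 0 < T_L → 0 < T_R →
      P.IsSteadyState N T_L T_R (μ T_L T_R) ∧
        ∀ ν : Measure (PhaseSpace N), P.IsSteadyState N T_L T_R ν → ν = μ T_L T_R) :
    ∀ᶠ δ in 𝓝 (0 : ℝ), μ (T + δ / 2) (T - δ / 2) = μ T T := by
  have hball : ∀ᶠ δ in 𝓝 (0 : ℝ), |δ| < 2 * T := by
    have : Metric.ball (0 : ℝ) (2 * T) ∈ 𝓝 (0 : ℝ) := Metric.ball_mem_nhds 0 (by positivity)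
    filter_upwards [this] with δ hδ
    simpa [Real.dist_eq] using hδ
  filter_upwards [hball] with δ hδ
  have h1 : 0 < T + δ / 2 := by
    have := neg_abs_le δ
    linarith
  have h2 : 0 < T - δ / 2 := by
    have := le_abs_self δ
    linarith
  have hst : P.IsSteadyState N T T (μ (T + δ / 2) (T - δ / 2)) :=
    (isSteadyState_iff_of_le_one P hN (by ring) _).mp (hμ _ _ h1 h2).1
  exact (hμ T T hT hT).2 _ hst

/-- **The stub for `N ≤ 1` (any oscillator chain), with response density `U = 0`.** If the weak
steady family `μ` is unique at every pair of positive bath temperatures (only uniqueness at `(T, T)`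
and steadiness near it are used) and `T > 0`, then `U = 0` is square-integrable for the Gibbs
measure, and `δ ↦ ∫ g dμ_{T+δ/2,T-δ/2}` (every observable `g`) and `δ ↦ totalCurrent μ_{T+δ/2,T-δ/2}`
are constant near `δ = 0`, so they have derivative `0 = ∫ g · 0 dμ_T = ∑_i ∫ j_i · 0 dμ_T` there. -/
theorem of_le_one (P : OscillatorChain) {N : ℕ} (hN : N ≤ 1) {T : ℝ} (hT : 0 < T)
    (μ : ℝ → ℝ → Measure (PhaseSpace N))
    (hμ : ∀ T_L T_R : ℝ, 0 < T_L → 0 < T_R →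
      P.IsSteadyState N T_L T_R (μ T_L T_R) ∧
        ∀ ν : Measure (PhaseSpace N), P.IsSteadyState N T_L T_R ν → ν = μ T_L T_R) :
    ∃ U : PhaseSpace N → ℝ,
      MemLp U 2 (P.gibbsMeasure N T) ∧
        (∀ g : PhaseSpace N → ℝ, ContDiff ℝ ((⊤ : ℕ∞) : WithTop ℕ∞) g → HasCompactSupport g →
            HasDerivAt (fun δ : ℝ => ∫ x, g x ∂(μ (T + δ / 2) (T - δ / 2)))
              (∫ x, g x * U x ∂(P.gibbsMeasure N T)) 0) ∧
        HasDerivAt (fun δ : ℝ => P.totalCurrent (μ (T + δ / 2) (T - δ / 2)))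
          (∑ i : Fin N, ∫ x, P.bondCurrent N i x * U x ∂(P.gibbsMeasure N T)) 0 := by
  have hev := steadyFamily_eventuallyEq_nhds_of_le_one P hN hT μ hμ
  refine ⟨0, MemLp.zero, fun g _ _ => ?_, ?_⟩
  · simp only [Pi.zero_apply, mul_zero, integral_zero]
    refine (hasDerivAt_const (0 : ℝ) (∫ x, g x ∂(μ T T))).congr_of_eventuallyEq ?_
    filter_upwards [hev] with δ hδ
    rw [hδ]
  · simp only [Pi.zero_apply, mul_zero, integral_zero, Finset.sum_const_zero]
    refine (hasDerivAt_const (0 : ℝ) (P.totalCurrent (μ T T))).congr_of_eventuallyEq ?_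
    filter_upwards [hev] with δ hδ
    rw [hδ]

/-! ### The bridge from difference quotients (item 9144's form) to `HasDerivAt` at `0` -/

/-- A limit of the difference quotients `δ⁻¹ (Φ(μ_{T+δ/2,T-δ/2}) - Φ(μ_{T,T}))` along `𝓝[≠] 0` is a
derivative at `0` of `δ ↦ Φ(μ_{T+δ/2,T-δ/2})` (`hasDerivAt_iff_tendsto_slope`; at `δ = 0` the family
sits at `(T, T)`). -/
theorem hasDerivAt_of_tendsto_slope {N : ℕ} {T : ℝ} (μ : ℝ → ℝ → Measure (PhaseSpace N))
    (Φ : Measure (PhaseSpace N) → ℝ) {c : ℝ}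
    (h : Tendsto (fun δ : ℝ => (Φ (μ (T + δ / 2) (T - δ / 2)) - Φ (μ T T)) / δ) (𝓝[≠] 0) (𝓝 c)) :
    HasDerivAt (fun δ : ℝ => Φ (μ (T + δ / 2) (T - δ / 2))) c 0 := by
  rw [hasDerivAt_iff_tendsto_slope]
  refine h.congr' (Eventually.of_forall fun δ => ?_)
  rw [slope_def_field]
  simp only [zero_div, add_zero, sub_zero]

/-- **Bridge.** For any chain `P`, if `μ T T` is the Gibbs measure `μ_T = P.gibbsMeasure N T` and
`h ∈ L²(μ T T)` represents the limits along `𝓝[≠] 0` of the difference quotients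
`δ⁻¹(∫ F dμ_{T+δ/2,T-δ/2} - ∫ F dμ_{T,T})` for every `F ∈ C_c^∞` AND for each bond current `j_i`
(the conclusion of item stmt-9144 `ResponseDensity` at `(T, N)`), then `U := h` satisfies the stub's
conclusion: `U ∈ L²(μ_T)`, `HasDerivAt (δ ↦ ∫ g dμ_δ) (∫ g U dμ_T) 0` for `g ∈ C_c^∞`, and
`HasDerivAt (δ ↦ totalCurrent μ_δ) (∑_i ∫ j_i U dμ_T) 0` (sum of the bond clauses). -/
theorem of_tendsto_slope (P : OscillatorChain) {N : ℕ} {T : ℝ}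
    (μ : ℝ → ℝ → Measure (PhaseSpace N)) (hπ : μ T T = P.gibbsMeasure N T)
    (h : PhaseSpace N → ℝ) (hh : MemLp h 2 (μ T T))
    (hF : ∀ F : PhaseSpace N → ℝ, ContDiff ℝ ((⊤ : ℕ∞) : WithTop ℕ∞) F → HasCompactSupport F →
      Tendsto (fun δ : ℝ => ((∫ x, F x ∂(μ (T + δ / 2) (T - δ / 2))) - ∫ x, F x ∂(μ T T)) / δ)
        (𝓝[≠] 0) (𝓝 (∫ x, F x * h x ∂(μ T T))))
    (hJ : ∀ i : Fin N, Tendsto (fun δ : ℝ =>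
        ((∫ x, P.bondCurrent N i x ∂(μ (T + δ / 2) (T - δ / 2))) -
          ∫ x, P.bondCurrent N i x ∂(μ T T)) / δ)
        (𝓝[≠] 0) (𝓝 (∫ x, P.bondCurrent N i x * h x ∂(μ T T)))) :
    ∃ U : PhaseSpace N → ℝ,
      MemLp U 2 (P.gibbsMeasure N T) ∧
        (∀ g : PhaseSpace N → ℝ, ContDiff ℝ ((⊤ : ℕ∞) : WithTop ℕ∞) g → HasCompactSupport g →
            HasDerivAt (fun δ : ℝ => ∫ x, g x ∂(μ (T + δ / 2) (T - δ / 2)))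
              (∫ x, g x * U x ∂(P.gibbsMeasure N T)) 0) ∧
        HasDerivAt (fun δ : ℝ => P.totalCurrent (μ (T + δ / 2) (T - δ / 2)))
          (∑ i : Fin N, ∫ x, P.bondCurrent N i x * U x ∂(P.gibbsMeasure N T)) 0 := by
  rw [← hπ]
  refine ⟨h, hh, fun g hg hgc => ?_, ?_⟩
  · exact hasDerivAt_of_tendsto_slope μ (fun ν => ∫ x, g x ∂ν) (hF g hg hgc)
  · have e : (fun δ : ℝ => P.totalCurrent (μ (T + δ / 2) (T - δ / 2))) =
        fun δ : ℝ => ∑ i ∈ Finset.univ,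
          (fun (i : Fin N) (δ' : ℝ) => ∫ x, P.bondCurrent N i x ∂(μ (T + δ' / 2) (T - δ' / 2))) i δ :=
      rfl
    rw [e]
    exact HasDerivAt.fun_sum fun i _ =>
      hasDerivAt_of_tendsto_slope μ (fun ν => ∫ x, P.bondCurrent N i x ∂ν) (hJ i)

/-! ### The pinned chain: identification of `μ T T` and the stub from items 0741 + 9144 -/

/-- Under uniqueness of the weak steady state at `(T, T)` (`T > 0`), the deterministic steady family
of `pinnedChain ω₂ lam β γ` (`ω₂ > 0`, `lam, β ≥ 0`) passes through the Gibbs measure: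
`μ T T = gibbsMeasure N T` (`pinnedChain_isSteadyState_gibbsMeasure`). -/
theorem steadyFamily_eq_gibbsMeasure {ω₂ lam β : ℝ} (hω : 0 < ω₂) (hl : 0 ≤ lam) (hβ : 0 ≤ β)
    (γ : ℝ) {N : ℕ} {T : ℝ} (hT : 0 < T) (μ : ℝ → ℝ → Measure (PhaseSpace N))
    (hμ : ∀ T_L T_R : ℝ, 0 < T_L → 0 < T_R →
      (pinnedChain ω₂ lam β γ).IsSteadyState N T_L T_R (μ T_L T_R) ∧
        ∀ ν : Measure (PhaseSpace N),
          (pinnedChain ω₂ lam β γ).IsSteadyState N T_L T_R ν → ν = μ T_L T_R) :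
    μ T T = (pinnedChain ω₂ lam β γ).gibbsMeasure N T :=
  ((hμ T T hT hT).2 _ (pinnedChain_isSteadyState_gibbsMeasure hω hl hβ γ N hT)).symm

/-- **The stub `stub_responseDensityDet`, verbatim, from the existing items stmt-0741
(`VanishingNoiseTransfer.NessUnique`) and stmt-9144 (`OddSectorIrreversibility.ResponseDensity`)
taken by name as hypotheses** (a conditional result; neither item is proved here). Proof: choose a
global reference steady family at all lengths (`pinnedChain_exists_isSteadyState`); it is a family of
weak steady states, so 9144 (whose uniqueness premise is 0741) yields a response density `h` for it
at `(T, N)`; the given per-`N` family coincides with the reference one at all positive temperatures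
by its own uniqueness clause, in particular near `δ = 0` and at `(T, T)`, where both are the Gibbs
measure; conclude by `of_tendsto_slope`. -/
theorem of_nessUnique_of_responseDensity
    (hNU : Summit.AtomisticToContinuum.FouriersLaw.Theses.VanishingNoiseTransfer.NessUnique)
    (hRD : Summit.AtomisticToContinuum.FouriersLaw.Theses.OddSectorIrreversibility.ResponseDensity) :
    ∀ ω₂ lam β γ : ℝ, 0 < ω₂ → 0 < lam → 0 < β → 0 < γ → ∀ T : ℝ, 0 < T → ∀ (N : ℕ)
    (μ : ℝ → ℝ → MeasureTheory.Measure
      (Literature.MathematicalPhysics.KineticTheory.HeatConduction.PhaseSpace N)),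
    (∀ T_L T_R : ℝ, 0 < T_L → 0 < T_R →
      (Literature.MathematicalPhysics.KineticTheory.HeatConduction.pinnedChain ω₂ lam β γ).IsSteadyState
          N T_L T_R (μ T_L T_R) ∧
        ∀ ν : MeasureTheory.Measure
          (Literature.MathematicalPhysics.KineticTheory.HeatConduction.PhaseSpace N),
          (Literature.MathematicalPhysics.KineticTheory.HeatConduction.pinnedChain ω₂ lam β γ).IsSteadyState
              N T_L T_R ν → ν = μ T_L T_R) →
    ∃ U : Literature.MathematicalPhysics.KineticTheory.HeatConduction.PhaseSpace N → ℝ,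
      MeasureTheory.MemLp U 2
          ((Literature.MathematicalPhysics.KineticTheory.HeatConduction.pinnedChain ω₂ lam β γ).gibbsMeasure
            N T) ∧
        (∀ g : Literature.MathematicalPhysics.KineticTheory.HeatConduction.PhaseSpace N → ℝ,
          ContDiff ℝ ((⊤ : ℕ∞) : WithTop ℕ∞) g → HasCompactSupport g →
            HasDerivAt (fun δ : ℝ => ∫ x, g x ∂(μ (T + δ / 2) (T - δ / 2)))
              (∫ x, g x * U x
                ∂((Literature.MathematicalPhysics.KineticTheory.HeatConduction.pinnedChain
                    ω₂ lam β γ).gibbsMeasure N T))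
              0) ∧
        HasDerivAt (fun δ : ℝ =>
            (Literature.MathematicalPhysics.KineticTheory.HeatConduction.pinnedChain ω₂ lam β γ).totalCurrent
              (μ (T + δ / 2) (T - δ / 2)))
          (∑ i : Fin N, ∫ x,
            (Literature.MathematicalPhysics.KineticTheory.HeatConduction.pinnedChain ω₂ lam β γ).bondCurrent
                N i x * U x
              ∂((Literature.MathematicalPhysics.KineticTheory.HeatConduction.pinnedChain
                  ω₂ lam β γ).gibbsMeasure N T))
          0 := by
  intro ω₂ lam β γ hω hl hβ hγ T hT N μ hμ
  have huniq : ∀ (M : ℕ) (T_L T_R : ℝ), 0 < T_L → 0 < T_R →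
      ∀ μ' ν : Measure (PhaseSpace M), (pinnedChain ω₂ lam β γ).IsSteadyState M T_L T_R μ' →
        (pinnedChain ω₂ lam β γ).IsSteadyState M T_L T_R ν → μ' = ν :=
    hNU ω₂ lam β γ hω hl hβ hγ
  -- a global reference steady family (by choice), steady at every length and positive temperatures
  let μref : (M : ℕ) → ℝ → ℝ → Measure (PhaseSpace M) := fun M T_L T_R =>
    if hLR : 0 < T_L ∧ 0 < T_R then
      Classical.choose (pinnedChain_exists_isSteadyState hω hl hβ hγ M hLR.1 hLR.2) else 0
  have hsteady : ∀ (M : ℕ) (T_L T_R : ℝ), 0 < T_L → 0 < T_R →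
      (pinnedChain ω₂ lam β γ).IsSteadyState M T_L T_R (μref M T_L T_R) := by
    intro M T_L T_R hL hR
    have hLR : 0 < T_L ∧ 0 < T_R := ⟨hL, hR⟩
    simp only [μref, dif_pos hLR]
    exact Classical.choose_spec (pinnedChain_exists_isSteadyState hω hl hβ hγ M hLR.1 hLR.2)
  obtain ⟨h, hh, hF, hJ⟩ := hRD ω₂ lam β γ hω hl hβ hγ huniq μref hsteady T hT N
  -- the given family is the reference family at level `N`
  have heq : ∀ T_L T_R : ℝ, 0 < T_L → 0 < T_R → μ T_L T_R = μref N T_L T_R :=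
    fun T_L T_R hL hR => ((hμ T_L T_R hL hR).2 _ (hsteady N T_L T_R hL hR)).symm
  have hTT : μ T T = μref N T T := heq T T hT hT
  have hev : ∀ᶠ δ in 𝓝[≠] (0 : ℝ), μ (T + δ / 2) (T - δ / 2) = μref N (T + δ / 2) (T - δ / 2) := by
    have hball : ∀ᶠ δ in 𝓝 (0 : ℝ), |δ| < 2 * T := by
      have : Metric.ball (0 : ℝ) (2 * T) ∈ 𝓝 (0 : ℝ) := Metric.ball_mem_nhds 0 (by positivity)
      filter_upwards [this] with δ hδ
      simpa [Real.dist_eq] using hδ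
    refine (hball.filter_mono nhdsWithin_le_nhds).mono fun δ hδ => ?_
    have h1 : 0 < T + δ / 2 := by
      have := neg_abs_le δ
      linarith
    have h2 : 0 < T - δ / 2 := by
      have := le_abs_self δ
      linarith
    exact heq _ _ h1 h2
  have hπ : μ T T = (pinnedChain ω₂ lam β γ).gibbsMeasure N T :=
    steadyFamily_eq_gibbsMeasure hω hl.le hβ.le γ hT μ hμ
  refine of_tendsto_slope (pinnedChain ω₂ lam β γ) μ hπ h (by rw [hTT]; exact hh) ?_ ?_
  · intro F hFc hFs
    have hlim := hF F hFc hFs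
    rw [← hTT] at hlim
    refine hlim.congr' ?_
    filter_upwards [hev] with δ hδ
    rw [hδ]
  · intro i
    have hlim := hJ i
    rw [← hTT] at hlim
    refine hlim.congr' ?_
    filter_upwards [hev] with δ hδ
    rw [hδ]


/-! ### Registered helper sub-goals (stub form, one line each) -/

/-- Registered helper sub-goal `helper_responseDensityDetLeOne` of stub `stub_responseDensityDet`
(= `of_le_one` in stub form): the stub's conclusion for every chain with at most one site, `U = 0`. -/
theorem helper_responseDensityDetLeOne : ∀ (P : Literature.MathematicalPhysics.KineticTheory.HeatConduction.OscillatorChain) (N : ℕ), N ≤ 1 → ∀ (T : ℝ), 0 < T → ∀ (μ : ℝ → ℝ → MeasureTheory.Measure (Literature.MathematicalPhysics.KineticTheory.HeatConduction.PhaseSpace N)), (∀ T_L T_R : ℝ, 0 < T_L → 0 < T_R → P.IsSteadyState N T_L T_R (μ T_L T_R) ∧ ∀ ν : MeasureTheory.Measure (Literature.MathematicalPhysics.KineticTheory.HeatConduction.PhaseSpace N), P.IsSteadyState N T_L T_R ν → ν = μ T_L T_R) → ∃ U : Literature.MathematicalPhysics.KineticTheory.HeatConduction.PhaseSpace N → ℝ,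 MeasureTheory.MemLp U 2 (P.gibbsMeasure N T) ∧ (∀ g : Literature.MathematicalPhysics.KineticTheory.HeatConduction.PhaseSpace N → ℝ, ContDiff ℝ ((⊤ : ℕ∞) : WithTop ℕ∞) g → HasCompactSupport g → HasDerivAt (fun δ : ℝ => ∫ x, g x ∂(μ (T + δ / 2) (T - δ / 2))) (∫ x, g x * U x ∂(P.gibbsMeasure N T)) 0) ∧ HasDerivAt (fun δ : ℝ => P.totalCurrent (μ (T + δ / 2) (T - δ / 2))) (∑ i : Fin N, ∫ x, P.bondCurrent N i x * U x ∂(P.gibbsMeasure N T)) 0 :=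
  fun P _ hN _ hT μ hμ => of_le_one P hN hT μ hμ

/-- Registered helper sub-goal `helper_responseDensityDetOfItems` of stub `stub_responseDensityDet`
(= `of_nessUnique_of_responseDensity` in stub form): the stub verbatim from items stmt-0741
(`NessUnique`) and stmt-9144 (`ResponseDensity`) taken by name. -/
theorem helper_responseDensityDetOfItems : Summit.AtomisticToContinuum.FouriersLaw.Theses.VanishingNoiseTransfer.NessUnique → Summit.AtomisticToContinuum.FouriersLaw.Theses.OddSectorIrreversibility.ResponseDensity → ∀ ω₂ lam β γ : ℝ, 0 < ω₂ → 0 < lam → 0 < β → 0 < γ → ∀ T : ℝ, 0 < T → ∀ (N : ℕ) (μ : ℝ → ℝ → MeasureTheory.Measure (Literature.MathematicalPhysics.KineticTheory.HeatConduction.PhaseSpace N)), (∀ T_L T_R : ℝ, 0 < T_L → 0 < T_R → (Literature.MathematicalPhysics.KineticTheory.HeatConduction.pinnedChain ω₂ lam β γ).IsSteadyState N T_L T_R (μ T_L T_R) ∧ ∀ ν : MeasureTheory.Measure (Literature.MathematicalPhysics.KineticTheory.HeatConduction.PhaseSpace N), (Literature.MathematicalPhysics.KineticTheory.HeatConduction.pinnedChain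 ω₂ lam β γ).IsSteadyState N T_L T_R ν → ν = μ T_L T_R) → ∃ U : Literature.MathematicalPhysics.KineticTheory.HeatConduction.PhaseSpace N → ℝ, MeasureTheory.MemLp U 2 ((Literature.MathematicalPhysics.KineticTheory.HeatConduction.pinnedChain ω₂ lam β γ).gibbsMeasure N T) ∧ (∀ g : Literature.MathematicalPhysics.KineticTheory.HeatConduction.PhaseSpace N → ℝ, ContDiff ℝ ((⊤ : ℕ∞) : WithTop ℕ∞) g → HasCompactSupport g → HasDerivAt (fun δ : ℝ => ∫ x, g x ∂(μ (T + δ / 2) (T - δ / 2))) (∫ x, g x * U x ∂((Literature.MathematicalPhysics.KineticTheory.HeatConduction.pinnedChain ω₂ lam β γ).gibbsMeasure N T)) 0) ∧ HasDerivAt (fun δ : ℝ => (Literature.MathematicalPhysics.KineticTheory.HeatConduction.pinnedChain ω₂ lam β γ).totalCurrent (μ (T + δ / 2) (T - δ / 2))) (∑ i : Fin N, ∫ x, (Literature.MathematicalPhysics.KineticTheory.HeatConduction.pinnedChain ω₂ lam β γ).bondCurrent N i x * U x ∂((Literature.MathematicalPhysics.KineticTheory.HeatConduction.pinnedChain ω₂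 lam β γ).gibbsMeasure N T)) 0 :=
  of_nessUnique_of_responseDensity

end Summit.AtomisticToContinuum.FouriersLaw.Theorems.NoiseLocality.StubResponseDensityDet

end
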